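import Summits.ABC.StewartYu.PadicTwistPMHalfStep
import Summits.ABC.StewartYu.PadicTwistPMRoots
import HarnessLib

/-!
# Cell abc-stewartyu, WP-Y provider B (xviii): the half-step PROVIDER of the ± chain with all algebraic
# data discharged — only numerics remain

`Summits/ABC/StewartYu/PadicTwistPMHalfProvider.lean` — cell `abc-stewartyu`, seat p3 (crux `W80OneModFour`
stmt-ABC-19487). `halfStepPM_of_numerics`: for ANY twisted set-up (any twist order), the signed Kummer
condition and the per-`(s,τ)` numerics (room, denominators `D`/`Rint` of `rHalf`, size `Mb`, the half-step
inequality with Liouville exponent `2^{d+2}`) give `HalfStepPM`. All the exponent / `ℂ_p` data required by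
`halfStep_pm_of` are produced HERE: `ζ` a primitive `(p−1)`-th root of unity (`ζ^{(p−1)/2} = −1`),
`ηᵢ = ζ^{rᵢ}` (`PadicTwistPMRoots`), `ξ² = ζ`, `ι = ξ^{(p−1)/2}` in `ℂ_p`, `ŝᵢ = psqrt(ωᵢ)·ξ^{−rᵢ}`.
[folklore].
-/

noncomputable section

open NormedSpace Finset IsUltrametricDist
open Literature.NumberTheory.Transcendental
open Literature.NumberTheory.Transcendental.CW77.Setup (Idx Tau tauNorm)
open scoped Nat

namespace Summit.ABC.StewartYu

namespace TwistSetup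

variable {p : ℕ} [Fact p.Prime] (S : TwistSetup p) {h Lb : ℕ}

/-- **Provider B with the algebraic data discharged**: signed Kummer + numerics ⇒ `HalfStepPM`.
[folklore] -/
theorem halfStepPM_of_numerics {J₀ J : ℕ} (hJ : J < J₀) {L : Fin S.d → ℕ} {Lθ S₀ T t : ℕ} {P : ℤ}
    (ht : 1 ≤ t) (hΛ : ‖S.Λ₀‖ ≤ (p : ℝ)⁻¹)
    (hroom : ∀ τ : Tau S.d, tauNorm τ < T / 2 ^ (J + 1) → tauNorm τ + t ≤ T / 2 ^ J - S.d * t)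
    (hind : ∀ T : Finset (Fin (S.d + 1)), T.Nonempty →
      ¬ IsSquare (∏ j ∈ T, S.toQ.all j) ∧ ¬ IsSquare (-∏ j ∈ T, S.toQ.all j))
    (D : ℕ → Tau S.d → ℕ) (hD : ∀ s τ, 1 ≤ D s τ) (Rint : ℕ → Tau S.d → Idx S.d h Lb → ℤ)
    (hR : ∀ s (τ : Tau S.d), ∀ u ∈ S.toQ.flat.box (h := h) (Lb := Lb) L Lθ J,
      (D s τ : ℚ) * ((S.frame.qΔ J₀ (J + 1) u τ.1 s * S.frame.qA u τ.2) * S.toQ.qEh u s) = Rint s τ u)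
    (Mb : ℕ → Tau S.d → ℝ) (hMb : ∀ s τ, 1 ≤ Mb s τ)
    (hMbP : ∀ s (τ : Tau S.d), ∑ u ∈ S.toQ.flat.box (h := h) (Lb := Lb) L Lθ J,
      (P : ℝ) * |((S.frame.qΔ J₀ (J + 1) u τ.1 s * S.frame.qA u τ.2 * S.toQ.qEh u s : ℚ) : ℝ)| ≤ Mb s τ)
    (hfinal : ∀ s, s < 2 ^ (J + 1) * S₀ → Odd s → ∀ τ : Tau S.d, tauNorm τ < T / 2 ^ (J + 1) →
      max ((p : ℝ) ^ (h * Lb / (p - 1)) * ‖S.Λ₀‖ * (p : ℝ) ^ ((t - 1) / (p - 1)) *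
            (p : ℝ) ^ PadicCW77.condExp p (2 ^ (S.d + J) * S₀ / 2) t)
          ((p : ℝ) ^ (h * Lb) / Real.sqrt p ^ ((2 ^ (S.d + J) * S₀ / 2) * t)) <
        (D s τ : ℝ) / (4 * (D s τ : ℝ) ^ 2 * Mb s τ *
          Literature.NumberTheory.Transcendental.CW77.heightProd S.toQ.all ^ 3) ^ (2 ^ (S.d + 1 + 1))) :
    S.HalfStepPM (h := h) (Lb := Lb) J₀ J L Lθ S₀ T t P := by
  have hp : p.Prime := Fact.out
  -- the primitive root and the exponents
  obtain ⟨ζ, hζ, hζM, hζ1⟩ := TwistExistsAnyOrder.exists_primitiveRoot (p := p) S.hp3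
  obtain ⟨r, hr⟩ := TwistExistsAnyOrder.exists_pows_eq_of_pow_eq_one S.hp3 hζ1 hζ S.hG S.η S.hηG
  have hη : ∀ i, S.η i = ζ ^ r i := fun i => (hr i).2
  -- `2M = p − 1`
  set M : ℕ := (p - 1) / 2 with hMdef
  have hodd : Odd p := hp.odd_of_ne_two (by have := S.hp3; omega)
  have h2M : 2 * M = p - 1 := by obtain ⟨k, hk⟩ := hodd; omega
  have hM : 0 < M := by have := S.hp3; omega
  have hζ' : IsPrimitiveRoot ζ (2 * M) := by rw [h2M]; exact hζ
  -- the `ℂ_p` data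
  obtain ⟨ξ, ιC, hξ2, hι, hι2, hξ⟩ := TwistExistsAnyOrder.exists_sqrt_root_padicComplex hζ1 (M := M) hζM
  obtain ⟨ŝ, hσ, hŝ, hŝ1⟩ := S.exists_root_data r hη hξ2 hξ
  exact S.halfStep_pm_of hJ ht hΛ hroom hM hζ' r hη ŝ ξ ιC hσ hι hι2 hξ hŝ hŝ1 hind D hD Rint hR Mb hMb
    hMbP hfinal

end TwistSetup

end Summit.ABC.StewartYu

end
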